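import Literature.NumberTheory.GaloisRepresentations.WeilDeligneRep
import Literature.NumberTheory.Automorphic.LParameter
import HarnessLib

/-!
# The Weil–Deligne representation of an `ℓ`-adic representation of `Γ_F` (`ℓ ≠ p`)

Trunk: GaloisRepresentations (support for the summit statement `Langlands`, lang.S02: local–global
compatibility at the finite places `v ∤ ℓ`).

Let `F` be a non-archimedean local field (`[IsNonarchimedeanLocalField F]`, Mathlib) with Weil
group `W_F = Literature.NumberTheory.GaloisRepresentations.WeilGroup F` (accepted `WeilGroup`: `deg` of an arithmetic Frobenius is `+1`,
`‖w‖ = q ^ deg w`), and `E` a field of characteristic zero (intended `E = ℚ̄_ℓ = PadicAlgCl ℓ`).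
The accepted `WeilDeligneRep` file states the Grothendieck–Deligne dictionary
`ρ ↦ WD(ρ) = (ρ_WD, N)` only as an *existence* named fact (`exists_weilDeligneRep_of_ladic`). To
PHRASE local–global compatibility one needs the dictionary as a *relation*; this file provides it,
copying the printed recipe verbatim, together with two bookkeeping relations:

* `Literature.NumberTheory.GaloisRepresentations.FramedRep.toWeilGroupHom ρ : W_F →* GL_n(E)` — restriction of `ρ : Γ_F →ₜ* GL_n(E)`
  along the accepted inclusion `WeilGroup.toAbsGalois F : W_F →* Γ_F` (as a bare homomorphism:
  continuity of the inclusion is the accepted named fact `WeilGroup.continuous_toAbsGalois`,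
  discharged in `LParameter`, and is not needed to state the recipe).
* `Literature.IsWeilDeligneOfLadic ρW r` — `r = (ρ_WD, N)` on `Fin n → E` **is a Weil–Deligne
  representation attached to** `ρW : W_F →* GL_n(E)`: there are a homomorphism
  `t : I_F → E` (the `ℓ`-adic tame character composed with `ℤ_ℓ(1) → E`), an open subgroup
  `U ≤ I_F` and a geometric Frobenius `Φ` (`deg Φ = -1`) with `ρW(u) = exp(t(u) N)` on `U` and
  `ρ_WD(Φ^m u) = ρW(Φ^m u) exp(-t(u) N)` for all `m ∈ ℤ`, `u ∈ I_F`, with `t` NON-TRIVIAL on `U`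
  — the body of the accepted `exists_weilDeligneRep_of_ladic` plus that non-degeneracy clause
  (Deligne 1973, §8.4.2; Tate 1979, (4.2.1); audit 2026-08-14: `t = 1` would be junk). The
  isomorphism class of `r` does not depend on `(t, U, Φ)` (Deligne, loc. cit.), so as a relation
  it pins `r` up to `WeilDeligneRep.IsEquivalent`; recorded as the named fact
  `IsWeilDeligneOfLadic.isEquivalent`.
* `Literature.NumberTheory.GaloisRepresentations.WeilDeligneRep.IsTransportAlong ι r r'` — `r'` (over `C`) is `r` (over `E`) with scalars
  moved along the ring homomorphism `ι : E →+* C` (intended: `ι : ℚ̄_ℓ ≃+* ℂ`, Buzzard–Gee's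
  "reluctant" `ι`): the matrices of `ρ'(w)` and `N'` are the entrywise images of those of `ρ(w)`,
  `N`. Weil–Deligne representations carry no topology on the coefficients, which is exactly why
  they can be moved along an abstract field isomorphism (Deligne 1973, §8.4.3; Tate 1979, (4.1.2)).
* `Literature.NumberTheory.GaloisRepresentations.WeilDeligneRep.HasFrobSemisimpleClass r c` — the Frobenius-semisimplification `r^{F-ss}`
  (accepted `IsFrobSemisimplificationOf`) has class `c` in the accepted quotient
  `Quotient (frobSemisimpleWDSetoid F n)`, the target of the local Langlands map `rec_n`.

No `sorry`; the only unproved assertion is the named fact `IsWeilDeligneOfLadic.isEquivalent`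
(`def … : Prop`, D-0014). Mathlib has none of this (no Weil–Deligne representations).

## References

* P. Deligne, *Les constantes des équations fonctionnelles des fonctions `L`*, Antwerp II,
  LNM 349 (1973), §8.4. [DeligneAntwerpII1973]
* J. Tate, *Number theoretic background*, Corvallis 1979, (4.1.2)–(4.2.1). [TateCorvallis1979]
* J.-P. Serre, J. Tate, *Good reduction of abelian varieties*, Ann. of Math. 88 (1968), Appendix.
  [SerreTate1968]
-/

noncomputable section

open Module

namespace Literature.NumberTheory.GaloisRepresentations

variable {F : Type*} [Field F] [ValuativeRel F] [TopologicalSpace F] [IsNonarchimedeanLocalField F]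

/-! ### Restriction of a Galois representation to the Weil group -/

/-- The restriction `ρ|_{W_F} : W_F →* GL_n(E)` of a framed representation
`ρ : Γ_F →ₜ* GL_n(E)` of the absolute Galois group of the local field `F` along the inclusion
`W_F ↪ Γ_F` (accepted `WeilGroup.toAbsGalois`), as a group homomorphism.
[cite: TateCorvallis1979, (1.4.1) and (4.2.1)] -/
def FramedRep.toWeilGroupHom {E : Type*} [CommRing E] [TopologicalSpace E] {n : ℕ}
    (ρ : FramedRep (Field.absoluteGaloisGroup F) E n) : WeilGroup F →* GL (Fin n) E :=
  ρ.toMonoidHom.comp (WeilGroup.toAbsGalois F)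

/-- Unfolding lemma for `FramedRep.toWeilGroupHom`. [folklore] -/
@[simp] theorem FramedRep.toWeilGroupHom_apply {E : Type*} [CommRing E] [TopologicalSpace E]
    {n : ℕ} (ρ : FramedRep (Field.absoluteGaloisGroup F) E n) (w : WeilGroup F) :
    ρ.toWeilGroupHom w = ρ (WeilGroup.toAbsGalois F w) := rfl

/-! ### The Grothendieck–Deligne dictionary as a relation -/

section Ladic

variable {E : Type*} [Field E] [CharZero E] {n : ℕ}

/-- **`r` is a Weil–Deligne representation attached to the `ℓ`-adic representation `ρW` of
`W_F`** (Grothendieck–Deligne; meaningful when the residue characteristic of `F` is not that of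
the coefficients, "`ℓ ≠ p`"). Verbatim the recipe of the accepted named fact
`exists_weilDeligneRep_of_ladic`: there are `t : I_F →* E` (additively written), an open
subgroup `U ≤ I_F` and `Φ ∈ W_F` with `deg Φ = -1` (a geometric Frobenius) such that
`ρW(u) = exp(t(u) • N)` for `u ∈ U` and `[ρ_WD(Φ^m u)] = ρW(Φ^m u) · exp(-(t(u) • N))` for all
`m : ℤ`, `u ∈ I_F` (`N` = the matrix of `r.N`, `exp` = Mathlib `IsNilpotent.exp`), and
**`t` is non-trivial on `U`** (as the genuine `ℓ`-adic tame character `t_ℓ : I_F ↠ ℤ_ℓ(1)` is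
on every open subgroup of inertia). Without the last clause the trivial `t = 1` would attach to
a `ρW` with finite inertia image EVERY `(ρW|, N)` whatever the nilpotent `N` (audit 2026-08-14:
`(ρ, 0)` and the Steinberg-type `(ρ, N ≠ 0)` for `ρ = diag(q^{deg}, 1)`), so the relation would
not pin `r` up to isomorphism; with it, `N` is determined up to the scalar `t_ℓ(u)/t(u)`, i.e.
`r` up to isomorphism (Deligne 1973, §8.4.2).
[cite: DeligneAntwerpII1973, §8.4.2] [cite: TateCorvallis1979, (4.2.1)] -/
def IsWeilDeligneOfLadic (ρW : WeilGroup F →* GL (Fin n) E)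
    (r : WeilDeligneRep F E (Fin n → E)) : Prop :=
  ∃ (t : WeilGroup.inertia F →* Multiplicative E) (U : Subgroup (WeilGroup F)) (Φ : WeilGroup F),
    U ≤ WeilGroup.inertia F ∧ IsOpen (U : Set (WeilGroup F)) ∧ WeilGroup.deg Φ = -1 ∧
    (∃ u : WeilGroup.inertia F, (u : WeilGroup F) ∈ U ∧ t u ≠ 1) ∧
    (∀ u : WeilGroup.inertia F, (u : WeilGroup F) ∈ U →
      ((ρW u : GL (Fin n) E) : Matrix (Fin n) (Fin n) E) =
        IsNilpotent.exp ((t u).toAdd • LinearMap.toMatrix' r.N)) ∧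
    (∀ (m : ℤ) (u : WeilGroup.inertia F),
      LinearMap.toMatrix' (r.ρ (Φ ^ m * u)) =
        ((ρW (Φ ^ m * u) : GL (Fin n) E) : Matrix (Fin n) (Fin n) E) *
          IsNilpotent.exp (-((t u).toAdd • LinearMap.toMatrix' r.N)))

/-- **Independence of choices.** Two Weil–Deligne representations attached to the same `ρW` by
the Grothendieck–Deligne recipe (for possibly different `t`, `U`, `Φ`) are isomorphic. Named fact
(D-0014). [cite: DeligneAntwerpII1973, §8.4.2] -/
def IsWeilDeligneOfLadic.isEquivalent : Prop :=
  ∀ {F : Type*} [Field F] [ValuativeRel F] [TopologicalSpace F] [IsNonarchimedeanLocalField F]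
    {E : Type*} [Field E] [CharZero E] {n : ℕ} (ρW : WeilGroup F →* GL (Fin n) E)
    (r r' : WeilDeligneRep F E (Fin n → E)),
    IsWeilDeligneOfLadic ρW r → IsWeilDeligneOfLadic ρW r' → r.IsEquivalent r'

end Ladic

/-! ### Moving the coefficients along `ι`, and the Frobenius-semisimple class -/

namespace WeilDeligneRep

variable {E : Type*} [Field E] [CharZero E] {C : Type*} [Field C] [CharZero C] {n : ℕ}

/-- **`r'` is `r` transported along `ι : E →+* C`** (`r` on `Fin n → E`, `r'` on `Fin n → C`):
for every `w ∈ W_F` the matrix of `r'.ρ w` is the entrywise `ι`-image of the matrix of `r.ρ w`,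
and likewise for the monodromy operators. Weil–Deligne representations have discrete
coefficients, so this is the honest "`ι(r)`" of Buzzard–Gee / Taylor for `ι : ℚ̄_ℓ ≃ ℂ`.
[cite: DeligneAntwerpII1973, §8.4.3] [cite: BuzzardGeeLMS2014, §3.2] -/
def IsTransportAlong (ι : E →+* C) (r : WeilDeligneRep F E (Fin n → E))
    (r' : WeilDeligneRep F C (Fin n → C)) : Prop :=
  (∀ w : WeilGroup F, LinearMap.toMatrix' (r'.ρ w) = (LinearMap.toMatrix' (r.ρ w)).map ι) ∧
    LinearMap.toMatrix' r'.N = (LinearMap.toMatrix' r.N).map ι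

/-- **The Frobenius-semisimplification of `r` has class `c`**: some (equivalently, by the accepted
named fact `existsUnique_frobSemisimplification`, the unique) Frobenius-semisimplification `r'`
of `r` (accepted `IsFrobSemisimplificationOf`: same `N`, same restriction to inertia, `r'.ρ w`
the semisimple part of `r.ρ w`) has isomorphism class `c` in
`Quotient (frobSemisimpleWDSetoid F n)` (accepted, `LParameter`).
[cite: DeligneAntwerpII1973, §8.6] [cite: TateCorvallis1979, (4.1.3)] -/
def HasFrobSemisimpleClass (r : WeilDeligneRep F ℂ (Fin n → ℂ))
    (c : Quotient (Literature.NumberTheory.Automorphic.frobSemisimpleWDSetoid F n)) : Prop :=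
  ∃ (r' : WeilDeligneRep F ℂ (Fin n → ℂ)) (h : r'.IsFrobSemisimplificationOf r),
    Quotient.mk (Literature.NumberTheory.Automorphic.frobSemisimpleWDSetoid F n)
      ⟨r', h.isFrobSemisimple⟩ = c

/-- A Frobenius-semisimple `r` has its own class. [folklore] -/
theorem IsFrobSemisimple.hasFrobSemisimpleClass {r : WeilDeligneRep F ℂ (Fin n → ℂ)}
    (h : r.IsFrobSemisimple) :
    r.HasFrobSemisimpleClass
      (Quotient.mk (Literature.NumberTheory.Automorphic.frobSemisimpleWDSetoid F n) ⟨r, h⟩) :=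
  ⟨r, h.isFrobSemisimplificationOf_self, rfl⟩

/-- Transport along `ι` is reflexive for `ι = id`. [folklore] -/
theorem isTransportAlong_refl (r : WeilDeligneRep F E (Fin n → E)) :
    r.IsTransportAlong (RingHom.id E) r :=
  ⟨fun w ↦ by simp, by simp⟩

end WeilDeligneRep

/-- With trivial monodromy the recipe returns `ρW` itself on `Φ^ℤ · I_F`, for ANY tame
character `t` non-trivial on `U`: if `r.N = 0`, `r.ρ` agrees with `ρW` (as matrices) on all
`Φ^m u`, and `ρW` is trivial on the open subgroup `U` of inertia, then `IsWeilDeligneOfLadic ρW r`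
— the unramified/finite-inertia sanity case of the dictionary (the genuine `t_ℓ` is such a `t`).
[cite: TateCorvallis1979, (4.1.3)–(4.2.1)] -/
theorem IsWeilDeligneOfLadic.of_N_eq_zero {E : Type*} [Field E] [CharZero E] {n : ℕ}
    (ρW : WeilGroup F →* GL (Fin n) E) (r : WeilDeligneRep F E (Fin n → E)) (hN : r.N = 0)
    (t : WeilGroup.inertia F →* Multiplicative E)
    (U : Subgroup (WeilGroup F)) (hU : U ≤ WeilGroup.inertia F)
    (hUo : IsOpen (U : Set (WeilGroup F)))
    (ht : ∃ u : WeilGroup.inertia F, (u : WeilGroup F) ∈ U ∧ t u ≠ 1)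
    (hker : ∀ u ∈ U, ρW u = 1) (Φ : WeilGroup F) (hΦ : WeilGroup.deg Φ = -1)
    (hρ : ∀ (m : ℤ) (u : WeilGroup.inertia F), LinearMap.toMatrix' (r.ρ (Φ ^ m * u)) =
      ((ρW (Φ ^ m * u) : GL (Fin n) E) : Matrix (Fin n) (Fin n) E)) :
    IsWeilDeligneOfLadic ρW r := by
  refine ⟨t, U, Φ, hU, hUo, hΦ, ht, fun u hu ↦ ?_, fun m u ↦ ?_⟩
  · rw [hker u hu, hN]
    simp
  · rw [hρ m u, hN]
    simp

end Literature.NumberTheory.GaloisRepresentations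

end
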